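import Summits.ValiantsHypothesis.ValiantsHypothesis.Theorems.BinomialElusivePeelingLemmaRigidity

/-!
# Rigidity, tail part: above the exceptional class everything dies (§3g STEP 3, "p_k = c₀, d ≡ 0 beyond v")

Helper for the crux stmt-ValiantsHypothesis-7391 (negative lane; `Cruxes/PeelingLemma/DETERMINISTIC-ALLX.md`
§3g STEP 3 / §3h (E4)).  Complement of `rigid_caseA` / `rigid_caseB`
(`BinomialElusivePeelingLemmaRigidity.lean`): if the alternating prefix sums `P` of the vertex
charges `g t = d t - d (t-1)` equal a constant `c₀` at every index off one residue class
`v (mod 2q+1)` (`v ≤ 2q`), and no nonzero value of `d` persists through any window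
`[v + k(2q+1) + 1, v + k(2q+1) + 2q]`, then `P s = c₀` for EVERY `s > v` (the on-class values
`p_k`, `k ≥ 1`, are `c₀` too) and `d t = 0` for every `t ≥ v+1` (`rigid_tail`).  With Case A
(`c₀ = 0`) resp. Case B (`c₀ = d 0`) this gives the full shape of `d` used in §3g: an arm whose
exceptional reading vanishes is entirely trivial.  Pointwise hypotheses; no Theses import.
-/

namespace Summit.ValiantsHypothesis.ValiantsHypothesis.Theorems.PeelingLemmaRigidity

-- summit = sub-problem name (single-conjunct summit, D-0017 layout), so the namespace repeats it
set_option linter.dupNamespace false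

/-- Residues: for `v ≤ 2q`, an index `t` with `v < t` and `t, t-1` both congruent… helper: if
`t % (2q+1) ≠ v` and `(t-1) % (2q+1) ≠ v` then `g t = 0` when `P` is constant off-class. -/
theorem g_zero_offclass {q v : ℕ} {P g : ℕ → ℤ} {c₀ : ℤ} (hoff : ∀ s, s % (2 * q + 1) ≠ v → P s = c₀)
    (hPg : ∀ t, 1 ≤ t → P t - P (t - 1) = (-1) ^ t * g t) (t : ℕ) (ht : 1 ≤ t)
    (h1 : t % (2 * q + 1) ≠ v) (h2 : (t - 1) % (2 * q + 1) ≠ v) : g t = 0 :=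
  g_eq_zero_of_P_eq hPg t ht (by rw [hoff t h1, hoff (t - 1) h2])

/-- Inside a window above an on-class index, indices are off-class: for `w = v + e` with `e` a
multiple of `2q+1` and `w < t ≤ w + 2q`, `t % (2q+1) ≠ v`. -/
theorem offclass_of_window {q v e t : ℕ} (hv : v ≤ 2 * q) (k : ℕ) (he : e = k * (2 * q + 1))
    (h1 : v + e < t) (h2 : t ≤ v + e + 2 * q) : t % (2 * q + 1) ≠ v := by
  subst he
  by_cases hr : t - (v + k * (2 * q + 1)) + v < 2 * q + 1
  · have ht : t = (t - (v + k * (2 * q + 1)) + v) + k * (2 * q + 1) := by omega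
    rw [ht, Nat.add_mul_mod_self_right, Nat.mod_eq_of_lt hr]
    omega
  · have ht : t = (t - (v + k * (2 * q + 1)) + v - (2 * q + 1)) + (2 * q + 1) + k * (2 * q + 1) := by
      omega
    rw [ht, Nat.add_mul_mod_self_right, Nat.add_mod_right, Nat.mod_eq_of_lt (by omega)]
    omega

/-- **Tail rigidity.**  See the file header (`1 ≤ q`). -/
theorem rigid_tail {q v : ℕ} (hq : 1 ≤ q) (hv : v ≤ 2 * q) (P g d : ℕ → ℤ) (c₀ : ℤ)
    (hoff : ∀ s, s % (2 * q + 1) ≠ v → P s = c₀)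
    (hPg : ∀ t, 1 ≤ t → P t - P (t - 1) = (-1) ^ t * g t)
    (hdg : ∀ t, 1 ≤ t → d t - d (t - 1) = g t)
    (hflat : ∀ k, (∀ t, v + k * (2 * q + 1) + 1 ≤ t → t ≤ v + k * (2 * q + 1) + 2 * q →
        d t = d (v + k * (2 * q + 1) + 1)) → d (v + k * (2 * q + 1) + 1) = 0) :
    (∀ s, v < s → P s = c₀) ∧ (∀ t, v + 1 ≤ t → d t = 0) := by
  -- Step 1: d vanishes on every window [v + e + 1, v + e + 2q], e = k(2q+1)
  have hwin0 : ∀ k t, v + k * (2 * q + 1) + 1 ≤ t → t ≤ v + k * (2 * q + 1) + 2 * q → d t = 0 := by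
    intro k
    set e := k * (2 * q + 1) with he
    have hconst : ∀ t, v + e + 1 ≤ t → t ≤ v + e + 2 * q → d t = d (v + e + 1) := fun t h1 h2 =>
      d_const_of_g_zero hdg h1 fun t' h1' h2' =>
        g_zero_offclass hoff hPg t' (by omega) (offclass_of_window hv k he (by omega) (by omega))
          (offclass_of_window hv k he (by omega) (by omega))
    have h0 := hflat k hconst
    intro t h1 h2
    rw [hconst t h1 h2, h0]
  -- Step 2: on-class values above v equal c₀
  have hon : ∀ k, 1 ≤ k → P (v + k * (2 * q + 1)) = c₀ := by
    intro k hk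
    set e' := (k - 1) * (2 * q + 1) with he'
    have hee : k * (2 * q + 1) = e' + (2 * q + 1) := by
      rw [he', ← Nat.sub_add_cancel hk, Nat.add_mul, one_mul, Nat.add_sub_cancel]
    set w := v + k * (2 * q + 1) with hw
    have hw' : w = v + e' + (2 * q + 1) := by rw [hw, hee]; ring
    -- d (w+1) = 0 (window k) and d (w-1) = 0 (window k-1, since w - 1 = v + e' + 2q)
    have hd1 : d (w + 1) = 0 := hwin0 k (w + 1) (by omega) (by omega)
    have hd0 : d (w - 1) = 0 := hwin0 (k - 1) (w - 1) (by rw [← he']; omega) (by rw [← he']; omega)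
    have hw1 : 1 ≤ w := by omega
    have hg1 := hdg w hw1
    have hg2 := hdg (w + 1) (by omega)
    rw [Nat.add_sub_cancel] at hg2
    have hP1 := hPg w hw1
    have hP2 := hPg (w + 1) (by omega)
    rw [Nat.add_sub_cancel] at hP2
    have hoff1 : P (w - 1) = c₀ :=
      hoff _ (offclass_of_window hv (k - 1) he' (by omega) (by omega))
    have hoff2 : P (w + 1) = c₀ :=
      hoff _ (offclass_of_window hv k rfl (by omega) (by omega))
    have hsq : ((-1 : ℤ) ^ w) * (-1) ^ w = 1 := by
      rw [← pow_add, ← two_mul]; exact Even.neg_one_pow (even_two_mul w)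
    have e1 : g w = (-1) ^ w * (P w - c₀) := by
      calc g w = ((-1 : ℤ) ^ w * (-1) ^ w) * g w := by rw [hsq, one_mul]
        _ = (-1) ^ w * ((-1) ^ w * g w) := by ring
        _ = (-1) ^ w * (P w - c₀) := by rw [← hP1, hoff1]
    have e2 : g (w + 1) = (-1) ^ w * (P w - c₀) := by
      calc g (w + 1) = ((-1 : ℤ) ^ w * (-1) ^ w) * g (w + 1) := by rw [hsq, one_mul]
        _ = -((-1) ^ w * ((-1) ^ (w + 1) * g (w + 1))) := by rw [pow_succ]; ring
        _ = (-1) ^ w * (P w - c₀) := by rw [← hP2, hoff2]; ring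
    have hsum : g w + g (w + 1) = 0 := by
      have : d (w + 1) - d (w - 1) = g w + g (w + 1) := by linarith
      rw [hd1, hd0, sub_zero] at this; linarith
    rw [e1, e2, ← two_mul] at hsum
    have hne : ((-1 : ℤ) ^ w) ≠ 0 := pow_ne_zero _ (by norm_num)
    have : P w - c₀ = 0 := by
      rcases mul_eq_zero.mp hsum with h | h
      · norm_num at h
      · exact (mul_eq_zero.mp h).resolve_left hne
    linarith
  -- Step 3: every s > v has P s = c₀
  have hall : ∀ s, v < s → P s = c₀ := by
    intro s hs
    by_cases hc : s % (2 * q + 1) = v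
    · obtain ⟨k, hk⟩ : ∃ k, s = v + k * (2 * q + 1) := by
        refine ⟨s / (2 * q + 1), ?_⟩
        have h := Nat.div_add_mod s (2 * q + 1)
        rw [hc, Nat.mul_comm] at h
        omega
      have hk1 : 1 ≤ k := by
        rcases Nat.eq_zero_or_pos k with h0 | h0
        · subst h0; omega
        · exact h0
      rw [hk]; exact hon k hk1
    · exact hoff s hc
  refine ⟨hall, ?_⟩
  -- Step 4: g t = 0 for t ≥ v + 2, so d is constant from v+1 on, where it is 0
  have hg0 : ∀ t, v + 2 ≤ t → g t = 0 := fun t ht =>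
    g_eq_zero_of_P_eq hPg t (by omega) (by rw [hall t (by omega), hall (t - 1) (by omega)])
  have hd1 : d (v + 1) = 0 := hwin0 0 (v + 1) (by omega) (by omega)
  intro t ht
  rw [d_const_of_g_zero hdg ht fun t' h1 _ => hg0 t' (by omega), hd1]

end Summit.ValiantsHypothesis.ValiantsHypothesis.Theorems.PeelingLemmaRigidity
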